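import Literature.Computability.QuantumComplexity.HidingIdealEvents
import Literature.Computability.QuantumComplexity.HidingIdealCore
import HarnessLib

/-!
# The ideal world of the proof of AA13 Thm. 1.3: the oracle event and the counter event

Family `quantum-advantage`, sequel of `HidingIdealEvents.lean` and `HidingIdealCore.lean`. The two
remaining events of the union bound of the discharge of Aaronson–Arkhipov's Thm. 1.3 involve the
two black boxes — the approximate BosonSampling oracle `𝒪` (Def. 3.11) and the Stockmeyer counter
`F` (Thm. 4.1) — through the other agent's `IdealParams` API (`ApproxBosonSamplingIdealSide.lean`):

* `uMat P W = gsUnit (yMat P W)`; on the Gram event it is column-orthonormal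
  (`isColumnOrthonormal_uMat`) and the machine's hidden matrix code is its honest rounding
  (`hiddenOf_entryArr_eq`: the clamp is a no-op);
* `DeltaBad` — the discrepancy `Δ_S = |p_S - q_S|` at the planted position exceeds `θ₂`;
  **`card_gram_deltaBad_le`** — jointly over `(S, W)`, fraction `≤ δ₀/4` as soon as the oracle's
  output law is `ε₀δ₀/24`-close to `𝒟_U` on every Gram-good array (eqs. (5.82)–(5.88),
  `card_badDelta_le`, the array being INDEPENDENT of the uniformly random position);
* `StockBadS` — the counter misses; **`card_stockBadS_le`** — jointly over `(S, W, u)`, fraction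
  `≤ 1/kδS` (eq. (5.89), `card_stockBad_le`);
* generic slicing lemmas `card_filter_prod_le_of_fst/snd` and the dictionary between injective
  position maps and embeddings (`card_filter_exists_injective_eq`).

All proved, no new named facts.

## References

* S. Aaronson, A. Arkhipov, *The computational complexity of linear optics*, Theory of Computing 9
  (2013) 143–252, proof of Thm. 1.3, eqs. (5.80)–(5.89) (pp. 193–194), Def. 3.11 (p. 174),
  Thm. 4.1 (p. 175).
-/

noncomputable section

namespace Literature.Computability.QuantumComplexity

open Finset Matrix Literature.Computability.Complexity Literature.Computability.Cryptography
  Literature.Probability.Distributions Literature.Probability.Moments Literature.LinearAlgebra.Matrix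
  Literature.Analysis.Matrix

/-! ### Generic slicing of counts over products -/

/-- Slicing a count over a product by the first coordinate. [folklore] -/
theorem card_filter_prod_le_of_fst {α β : Type*} [Fintype α] [Fintype β] (Q : α → β → Prop)
    [∀ a b, Decidable (Q a b)] {c : ℝ} (h : ∀ a, ((univ.filter fun b => Q a b).card : ℝ) ≤ c * Fintype.card β) :
    ((univ.filter fun p : α × β => Q p.1 p.2).card : ℝ) ≤ c * Fintype.card (α × β) := by
  classical
  have hslice : ((univ.filter fun p : α × β => Q p.1 p.2).card : ℝ) = ∑ a, ((univ.filter fun b => Q a b).card : ℝ) := by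
    rw [card_filter, Fintype.sum_prod_type]
    push_cast
    refine Finset.sum_congr rfl fun a _ => ?_
    rw [card_filter]
    push_cast
    rfl
  rw [hslice, Fintype.card_prod, Nat.cast_mul]
  calc ∑ a, ((univ.filter fun b => Q a b).card : ℝ) ≤ ∑ _a : α, c * Fintype.card β := Finset.sum_le_sum fun a _ => h a
    _ = c * (Fintype.card α * Fintype.card β) := by
        rw [Finset.sum_const, card_univ, nsmul_eq_mul]; ring

/-- Slicing a count over a product by the second coordinate. [folklore] -/
theorem card_filter_prod_le_of_snd {α β : Type*} [Fintype α] [Fintype β] (Q : α → β → Prop)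
    [∀ a b, Decidable (Q a b)] {c : ℝ} (h : ∀ b, ((univ.filter fun a => Q a b).card : ℝ) ≤ c * Fintype.card α) :
    ((univ.filter fun p : α × β => Q p.1 p.2).card : ℝ) ≤ c * Fintype.card (α × β) := by
  classical
  have hswap : (univ.filter fun p : α × β => Q p.1 p.2).card = (univ.filter fun p : β × α => Q p.2 p.1).card := by
    refine card_bij (fun p _ => (p.2, p.1)) (fun p hp => by simpa using hp) (fun p _ q _ h => ?_) fun p hp => ?_
    · simp only [Prod.mk.injEq] at h; exact Prod.ext h.2 h.1
    · exact ⟨(p.2, p.1), by simpa using hp, rfl⟩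
  rw [hswap, Fintype.card_prod, mul_comm (Fintype.card α), ← Fintype.card_prod]
  exact card_filter_prod_le_of_fst (fun b a => Q a b) h

/-- **Injective position maps versus embeddings**: counting `S` with `∃ h : Injective S, Q ⟨S, h⟩`
is counting embeddings with `Q`. [folklore] -/
theorem card_filter_exists_injective_eq {M n : ℕ} (Q : (Fin n ↪ Fin M) → Prop) [DecidablePred Q]
    [DecidablePred fun S : Fin n → Fin M => ∃ h : Function.Injective S, Q ⟨S, h⟩] :
    (univ.filter fun S : Fin n → Fin M => ∃ h : Function.Injective S, Q ⟨S, h⟩).card = (univ.filter Q).card := by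
  refine card_bij (fun S hS => ⟨S, ((mem_filter.1 hS).2).1⟩) (fun S hS => ?_) (fun S hS S' hS' h => ?_) fun ι hι => ?_
  · obtain ⟨h, hq⟩ := (mem_filter.1 hS).2
    simpa using hq
  · exact congrArg (fun ι : Fin n ↪ Fin M => (ι : Fin n → Fin M)) h
  · refine ⟨ι, ?_, ?_⟩
    · simp only [mem_filter, mem_univ, true_and] at hι ⊢
      exact ⟨ι.injective, by simpa using hι⟩
    · ext i; rfl

/-! ### The unit matrix of an array on the Gram event -/

variable (P : PGParams) {n e : ℕ}

/-- The exact Gram–Schmidt unit matrix of an array. [folklore] -/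
def uMat (W : Fin (n + e) → Fin n → EntryBlock P) : _root_.Matrix (Fin (n + e)) (Fin n) ℂ := gsUnit (yMat P W)

/-- **On the Gram event the unit matrix is column-orthonormal** (`t ≤ 1/4`, `8tn ≤ 1`).
[cite: AaronsonArkhipovToC2013, proof of Thm. 1.3, §5.2 (p. 192)] -/
theorem isColumnOrthonormal_uMat {t : ℝ} {W : Fin (n + e) → Fin n → EntryBlock P} (hG : GramGood P t (2 * 4 ^ P.b * P.v) W)
    (hN : 0 < ((n + e : ℕ) : ℝ) * (2 * 4 ^ P.b * P.v)) (ht0 : 0 ≤ t) (htn : 8 * t * n ≤ 1) (ht4 : t ≤ 1 / 4) :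
    IsColumnOrthonormal (uMat P W) :=
  conjTranspose_mul_gsUnit_of_nearOrthogonal hG.hG hN ht0 htn ht4

/-- **On the Gram event the hidden matrix code is the honest rounding** of the unit matrix.
[cite: AaronsonArkhipovToC2013, §5.2 (p. 192) with §2 (p. 161)] -/
theorem hiddenOf_entryArr_eq (bq : ℕ) {t : ℝ} {W : Fin (n + e) → Fin n → EntryBlock P}
    (hG : GramGood P t (2 * 4 ^ P.b * P.v) W) (hN : 0 < ((n + e : ℕ) : ℝ) * (2 * 4 ^ P.b * P.v)) (ht0 : 0 ≤ t)
    (htn : 8 * t * n ≤ 1) (ht4 : t ≤ 1 / 4) :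
    hiddenOf bq (entryArr P W) = fun r c => roundEntries bq (uMat P W) r c :=
  hiddenOf_eq_roundEntries bq (entryArr P W)
    (norm_apply_le_one_of_isColumnOrthonormal (isColumnOrthonormal_uMat P hG hN ht0 htn ht4))

/-! ### The oracle event: the discrepancy at the planted position -/

variable (IP : IdealParams)

/-- The hidden matrix code of an array. [folklore] -/
def eArr (W : Fin (n + e) → Fin n → EntryBlock P) : Fin (n + e) → Fin n → ℤ × ℤ := hiddenOf IP.b' (entryArr P W)

/-- The oracle's output law at the padded query on the code of an array (Def. 3.11). [cite: AaronsonArkhipovToC2013, Def. 3.11 (p. 174)] -/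
def lawArr (W : Fin (n + e) → Fin n → EntryBlock P) : PMF (List Bool) :=
  oracleSamplePMF IP.𝒪 IP.c (encodingBosonInput.encode ⟨n, e, IP.b', eArr P IP W⟩) IP.kβ

/-- **The discrepancy event**: the position is injective and `Δ_S = |p_S - q_S| > θ`. [cite: AaronsonArkhipovToC2013, proof of Thm. 1.3, eq. (5.88) (p. 194)] -/
def DeltaBad (θ : ℝ) (W : Fin (n + e) → Fin n → EntryBlock P) (S : Fin n → Fin (n + e)) : Prop :=
  ∃ h : Function.Injective S, θ < plantedDelta (uMat P W) (lawArr P IP W) ⟨S, h⟩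

open Classical in
/-- **The discrepancy event is rare, jointly over `(S, W)`**: if on every Gram-good array the
oracle's output law is `ε₀δ₀/24`-close to `𝒟_U` (the oracle's guarantee at a column-orthonormal
matrix, Def. 3.11), then `#{(S, W) | GramGood W ∧ Δ_S > (ε₀/2)/mⁿ} ≤ (δ₀/4) · #pairs` — for each
fixed array the bad positions are few (`card_badDelta_le`) and the position is independent of it.
[cite: AaronsonArkhipovToC2013, proof of Thm. 1.3, eqs. (5.82)–(5.88) (p. 194)] -/
theorem card_gram_deltaBad_le {t ε₀ δ₀ : ℝ} (hε : 0 < ε₀) (hδ : 0 ≤ δ₀) (hne : 3 * n ^ 2 ≤ n + e)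
    (hO : ∀ W : Fin (n + e) → Fin n → EntryBlock P, GramGood P t (2 * 4 ^ P.b * P.v) W →
      (lawArr P IP W).tvDist (bosonTargetPMF (uMat P W)) ≤ ε₀ * δ₀ / 24) :
    ((univ.filter fun q : (Fin n → Fin (n + e)) × (Fin (n + e) → Fin n → EntryBlock P) =>
        GramGood P t (2 * 4 ^ P.b * P.v) q.2 ∧ DeltaBad P IP (ε₀ / 2 / ((n + e : ℕ) : ℝ) ^ n) q.2 q.1).card : ℝ) ≤
      δ₀ / 4 * Fintype.card ((Fin n → Fin (n + e)) × (Fin (n + e) → Fin n → EntryBlock P)) := by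
  refine card_filter_prod_le_of_snd (fun S W => GramGood P t (2 * 4 ^ P.b * P.v) W ∧
    DeltaBad P IP (ε₀ / 2 / ((n + e : ℕ) : ℝ) ^ n) W S) fun W => ?_
  by_cases hG : GramGood P t (2 * 4 ^ P.b * P.v) W
  · have h := card_badDelta_le (U := uMat P W) (D := lawArr P IP W) hε hδ hne (hO W hG)
    have hcard : (univ.filter fun S : Fin n → Fin (n + e) => GramGood P t (2 * 4 ^ P.b * P.v) W ∧
        DeltaBad P IP (ε₀ / 2 / ((n + e : ℕ) : ℝ) ^ n) W S).card =
        (univ.filter fun ι : Fin n ↪ Fin (n + e) => ε₀ / 2 / ((n + e : ℕ) : ℝ) ^ n < plantedDelta (uMat P W) (lawArr P IP W) ι).card := by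
      rw [← card_filter_exists_injective_eq]
      congr 1
      ext S
      simp [hG, DeltaBad]
    rw [hcard]
    refine h.trans (mul_le_mul_of_nonneg_left ?_ (by positivity))
    rw [card_plantedPositions, Fintype.card_fun, Fintype.card_fin, Fintype.card_fin]
    exact_mod_cast Nat.descFactorial_le_pow _ _
  · have h0 : (univ.filter fun S : Fin n → Fin (n + e) => GramGood P t (2 * 4 ^ P.b * P.v) W ∧
        DeltaBad P IP (ε₀ / 2 / ((n + e : ℕ) : ℝ) ^ n) W S) = ∅ := filter_eq_empty_iff.2 fun S _ h => hG h.1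
    rw [h0, card_empty, Nat.cast_zero]
    positivity

/-! ### The counter event -/

/-- **The counter event**: the position is injective and the Stockmeyer counter misses at the
instance `⟨x', S⟩` (`IdealParams.stockBad`). [cite: AaronsonArkhipovToC2013, proof of Thm. 1.3, eq. (5.89) (p. 194)] -/
def StockBadS (W : Fin (n + e) → Fin n → EntryBlock P) (S : Fin n → Fin (n + e)) (u : List Bool) : Prop :=
  ∃ h : Function.Injective S, IP.stockBad (eArr P IP W) ⟨S, h⟩ u

open Classical in
/-- **The counter event is rare, jointly over `(S, W, u)`**: fraction `≤ 1/kδS` of the triples with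
`u ∈ {0,1}^{ℓ₂}` (the counter's guarantee at each fixed instance, `card_stockBad_le`).
[cite: AaronsonArkhipovToC2013, proof of Thm. 1.3, eq. (5.89) (p. 194) with Thm. 4.1 (p. 175)] -/
theorem card_stockBadS_le (hδS : 0 < IP.kδS)
    (hS : ∀ (x : List Bool) (ℓ : ℕ),
      uniformProb (IP.cS.eval (x.length + ℓ + IP.kη + IP.kδS))
        {u | ¬ IsApproxCount IP.kη (countWitnesses (samplerRel (oracleRandAlg IP.𝒪 IP.c)) ℓ x)
          (countEstimate IP.F x ℓ IP.kη IP.kδS u)} ≤ 1 / (IP.kδS : ℝ)) :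
    ((univ.filter fun q : ((Fin n → Fin (n + e)) × (Fin (n + e) → Fin n → EntryBlock P)) × List.Vector Bool IP.ℓ₂ =>
        StockBadS P IP q.1.2 q.1.1 q.2.toList).card : ℝ) ≤
      1 / (IP.kδS : ℝ) * Fintype.card (((Fin n → Fin (n + e)) × (Fin (n + e) → Fin n → EntryBlock P)) × List.Vector Bool IP.ℓ₂) := by
  refine card_filter_prod_le_of_fst (fun (q : (Fin n → Fin (n + e)) × (Fin (n + e) → Fin n → EntryBlock P))
    (u : List.Vector Bool IP.ℓ₂) => StockBadS P IP q.2 q.1 u.toList) fun q => ?_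
  by_cases hinj : Function.Injective q.1
  · have h := card_stockBad_le IP hδS hS (eArr P IP q.2) ⟨q.1, hinj⟩
    refine le_trans (le_of_eq ?_) h
    congr 2
    ext u
    simp only [mem_filter, mem_univ, true_and, StockBadS]
    exact ⟨fun ⟨_, hu⟩ => hu, fun hu => ⟨hinj, hu⟩⟩
  · have h0 : (univ.filter fun u : List.Vector Bool IP.ℓ₂ => StockBadS P IP q.2 q.1 u.toList) = ∅ :=
      filter_eq_empty_iff.2 fun u _ h => hinj h.1
    rw [h0, card_empty, Nat.cast_zero]
    positivity

end Literature.Computability.QuantumComplexity
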